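import Mathlib
import HarnessLib
import Summits.ValiantsHypothesis.ValiantsHypothesis.Theorems.SummationBitsRyserOptimalDepth3StubFlatteningRegime
import Summits.ValiantsHypothesis.ValiantsHypothesis.Theorems.SummationBitsRyserOptimalDepth3GradedNormalForm
import Summits.ValiantsHypothesis.ValiantsHypothesis.Theses.SummationBits

/-!
# Crux `SummationBits.RyserOptimalDepth3` (stmt-ValiantsHypothesis-7565), line `registered` —
# the GRADED heart is exactly the crux (certified normal form)

Support file (lead prover c1, `--supports stmt-ValiantsHypothesis-7565`).  The line `registered`
closes the crux from a single open stub.  Lead -0 registered that stub in the degree-`n`-only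
form H (`stub_esymHighDegree`: representations `per_n = Σ_{i<r} a_i e_n(m_i1, …, m_iD)` by
elementary symmetric polynomials of degree `n` in `D > n + t⌊log₂(n+2)⌋` linear forms have
`2^n ≤ r (D+1) (n+2)^c`), which is one factor `D + 1` STRONGER than the crux
(`ryserOptimal_imp_esymBound`).  This file records, as theorems, that the GRADED form of the heart
— the same bound for graded e-systems `Σ_i a_i e_k(m_i) = [per_n(x+u)]_k` (all `k`) — is
EQUIVALENT to the crux, so that the reshaped line can neither be killed nor closed without
settling the crux itself:

* `ryserOptimal_of_gradedHighDegree` — graded heart ⟹ `RyserOptimalDepth3` (the line's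
  composition: flattening regime `stub_flatteningRegime` for `D ≤ n + t⌊log₂(n+2)⌋`, graded
  normal form `GradedNormalForm.graded_esymNormalForm` + the heart beyond).
* `gradedHighDegree_of_ryserOptimal` — `RyserOptimalDepth3` ⟹ graded heart (with `t = 0`), from
  `ryserOptimal_imp_gradedBound` (graded e-system ⟹ affine expression, same `(r, D)`).
* `ryserOptimalDepth3_iff_gradedHighDegree`, `ryserOptimalDepth3_iff_gradedBound` — the two
  certified normal forms of the crux: Ryser is optimal at depth three up to `poly(n)` iff the
  graded symmetric model of depth three (Shpilka) obeys `2^n ≤ r (D+1) (n+2)^c`, in the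
  high-degree regime, equivalently at all degrees.
* `gradedHighDegree_of_esymHighDegree` — the degree-`n`-only heart H implies the graded heart
  (specialise the graded system at `k = n`, where `[per_n(x+u)]_n = per_n`), so a proof of H still
  closes the line.

No new mathematics: bookkeeping over the landed helpers of
`Theorems/SummationBitsRyserOptimalDepth3StubFlatteningRegime.lean` (p147725),
`…GradedNormalForm.lean` (p150640) and `…StubEsymNormalForm.lean` (p147416).  Reference for the
model: A. Shpilka, *Affine projections of symmetric polynomials*, J. Comput. System Sci. 65
(2002), §1 (symmetric model of depth three; Ben-Or's interpolation).
-/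

-- Sub = Summit layout; duplicated namespace component intended
set_option linter.dupNamespace false

namespace Summit.ValiantsHypothesis.ValiantsHypothesis.Theorems.SummationBitsRyserOptimalDepth3

open MvPolynomial
open Literature.Computability.AlgebraicComplexity

namespace GradedHeart

/-- **Graded heart ⟹ crux.**  If for some `t, c` every graded e-system
`Σ_i a_i e_k(m_i1, …, m_iD) = [per_n(x+u)]_k` (all `k`; `m_ij` linear) with
`D > n + t⌊log₂(n+2)⌋` has `2^n ≤ r (D+1) (n+2)^c`, then Ryser is optimal at depth three up to
`poly(n)`: for `D ≤ n + t⌊log₂(n+2)⌋` the flattening regime (`stub_flatteningRegime`) applies, and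
beyond it an affine expression is put into graded elementary-symmetric normal form with the same
`(r, D)` (`GradedNormalForm.graded_esymNormalForm`); the exponent is enlarged to `c + c(t)`.
[folklore] -/
theorem ryserOptimal_of_gradedHighDegree
    (h : ∃ t c : ℕ, ∀ n : ℕ, 1 ≤ n →
      ∀ (r D : ℕ) (u : Fin n × Fin n → ℂ) (a : Fin r → ℂ)
        (m : Fin r → Fin D → MvPolynomial (Fin n × Fin n) ℂ),
        (∀ i j, (m i j).IsHomogeneous 1) →
          (∀ k : ℕ, (∑ i, C (a i) * aeval (m i) (esymm (Fin D) ℂ k)) =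
            homogeneousComponent k (aeval (fun v => X v + C (u v)) (perPoly (Fin n) ℂ))) →
            n + t * Nat.log 2 (n + 2) < D → 2 ^ n ≤ r * (D + 1) * (n + 2) ^ c) :
    Summit.ValiantsHypothesis.ValiantsHypothesis.Theses.SummationBits.RyserOptimalDepth3 := by
  obtain ⟨t, c₁, hH⟩ := h
  obtain ⟨c₂, hF⟩ := stub_flatteningRegime t
  refine ⟨c₁ + c₂, fun n hn r D ℓ hℓ hsum => ?_⟩
  -- enlarging the exponent is harmless (`n + 2 ≥ 1`)
  have hmono : ∀ c : ℕ, c ≤ c₁ + c₂ → 2 ^ n ≤ r * (D + 1) * (n + 2) ^ c →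
      2 ^ n ≤ r * (D + 1) * (n + 2) ^ (c₁ + c₂) := fun c hc h =>
    h.trans (Nat.mul_le_mul_left _ (Nat.pow_le_pow_right (by omega) hc))
  by_cases hD : D ≤ n + t * Nat.log 2 (n + 2)
  · -- flattening regime
    exact hmono c₂ (by omega) (hF n hn r D ℓ hℓ hsum hD)
  · -- interpolation regime: graded elementary-symmetric normal form, then the heart
    obtain ⟨u, a, m, hm, hk⟩ := GradedNormalForm.graded_esymNormalForm ℓ hℓ hsum
    exact hmono c₁ (by omega) (hH n hn r D u a m hm hk (by omega))

/-- **Crux ⟹ graded heart** (threshold `t = 0`): a graded e-system with parameters `(r, D)` gives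
back an affine expression with the same `(r, D)` (`ryserOptimal_imp_gradedBound`). [folklore] -/
theorem gradedHighDegree_of_ryserOptimal
    (h : Summit.ValiantsHypothesis.ValiantsHypothesis.Theses.SummationBits.RyserOptimalDepth3) :
    ∃ t c : ℕ, ∀ n : ℕ, 1 ≤ n →
      ∀ (r D : ℕ) (u : Fin n × Fin n → ℂ) (a : Fin r → ℂ)
        (m : Fin r → Fin D → MvPolynomial (Fin n × Fin n) ℂ),
        (∀ i j, (m i j).IsHomogeneous 1) →
          (∀ k : ℕ, (∑ i, C (a i) * aeval (m i) (esymm (Fin D) ℂ k)) =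
            homogeneousComponent k (aeval (fun v => X v + C (u v)) (perPoly (Fin n) ℂ))) →
            n + t * Nat.log 2 (n + 2) < D → 2 ^ n ≤ r * (D + 1) * (n + 2) ^ c := by
  obtain ⟨c, hc⟩ := ryserOptimal_imp_gradedBound h
  exact ⟨0, c, fun n hn r D u a m hm hk _ => hc n hn r D u a m hm hk⟩

/-- **Certified normal form of the crux, I.**  `RyserOptimalDepth3` (Ryser is optimal at depth
three up to `poly(n)`) is EQUIVALENT to the graded heart of line `registered`: for some `t, c`,
every graded e-system for `per_n` in `D > n + t⌊log₂(n+2)⌋` linear forms has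
`2^n ≤ r (D+1) (n+2)^c`. [folklore] -/
theorem ryserOptimalDepth3_iff_gradedHighDegree :
    Summit.ValiantsHypothesis.ValiantsHypothesis.Theses.SummationBits.RyserOptimalDepth3 ↔
      ∃ t c : ℕ, ∀ n : ℕ, 1 ≤ n →
        ∀ (r D : ℕ) (u : Fin n × Fin n → ℂ) (a : Fin r → ℂ)
          (m : Fin r → Fin D → MvPolynomial (Fin n × Fin n) ℂ),
          (∀ i j, (m i j).IsHomogeneous 1) →
            (∀ k : ℕ, (∑ i, C (a i) * aeval (m i) (esymm (Fin D) ℂ k)) =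
              homogeneousComponent k (aeval (fun v => X v + C (u v)) (perPoly (Fin n) ℂ))) →
              n + t * Nat.log 2 (n + 2) < D → 2 ^ n ≤ r * (D + 1) * (n + 2) ^ c :=
  ⟨gradedHighDegree_of_ryserOptimal, ryserOptimal_of_gradedHighDegree⟩

/-- **Certified normal form of the crux, II.**  `RyserOptimalDepth3` is EQUIVALENT to the graded
symmetric-model bound at ALL degrees: for some `c`, every graded e-system
`Σ_i a_i e_k(m_i1, …, m_iD) = [per_n(x+u)]_k` (all `k`; `m_ij` linear; `n ≥ 1`) has
`2^n ≤ r (D+1) (n+2)^c`. [folklore] -/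
theorem ryserOptimalDepth3_iff_gradedBound :
    Summit.ValiantsHypothesis.ValiantsHypothesis.Theses.SummationBits.RyserOptimalDepth3 ↔
      ∃ c : ℕ, ∀ n : ℕ, 1 ≤ n →
        ∀ (r D : ℕ) (u : Fin n × Fin n → ℂ) (a : Fin r → ℂ)
          (m : Fin r → Fin D → MvPolynomial (Fin n × Fin n) ℂ),
          (∀ i j, (m i j).IsHomogeneous 1) →
            (∀ k : ℕ, (∑ i, C (a i) * aeval (m i) (esymm (Fin D) ℂ k)) =
              homogeneousComponent k (aeval (fun v => X v + C (u v)) (perPoly (Fin n) ℂ))) →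
              2 ^ n ≤ r * (D + 1) * (n + 2) ^ c :=
  ⟨ryserOptimal_imp_gradedBound, fun ⟨c, hc⟩ =>
    ryserOptimal_of_gradedHighDegree ⟨0, c, fun n hn r D u a m hm hk _ => hc n hn r D u a m hm hk⟩⟩

/-- **The degree-`n`-only heart H implies the graded heart**: specialise the graded system at
`k = n`, where the target `[per_n(x+u)]_n` is `per_n`
(`StubEsymNormalForm.homogeneousComponent_translate_perPoly`).  So a proof of the originally
registered stub `stub_esymHighDegree` still closes the reshaped line. [folklore] -/
theorem gradedHighDegree_of_esymHighDegree
    (h : ∃ t c : ℕ, ∀ n : ℕ, 1 ≤ n →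
      ∀ (r D : ℕ) (a : Fin r → ℂ) (m : Fin r → Fin D → MvPolynomial (Fin n × Fin n) ℂ),
        (∀ i j, (m i j).IsHomogeneous 1) →
          (∑ i, C (a i) * aeval (m i) (esymm (Fin D) ℂ n)) = perPoly (Fin n) ℂ →
            n + t * Nat.log 2 (n + 2) < D → 2 ^ n ≤ r * (D + 1) * (n + 2) ^ c) :
    ∃ t c : ℕ, ∀ n : ℕ, 1 ≤ n →
      ∀ (r D : ℕ) (u : Fin n × Fin n → ℂ) (a : Fin r → ℂ)
        (m : Fin r → Fin D → MvPolynomial (Fin n × Fin n) ℂ),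
        (∀ i j, (m i j).IsHomogeneous 1) →
          (∀ k : ℕ, (∑ i, C (a i) * aeval (m i) (esymm (Fin D) ℂ k)) =
            homogeneousComponent k (aeval (fun v => X v + C (u v)) (perPoly (Fin n) ℂ))) →
            n + t * Nat.log 2 (n + 2) < D → 2 ^ n ≤ r * (D + 1) * (n + 2) ^ c := by
  obtain ⟨t, c, hH⟩ := h
  refine ⟨t, c, fun n hn r D u a m hm hk hD => hH n hn r D a m hm ?_ hD⟩
  rw [hk n, StubEsymNormalForm.homogeneousComponent_translate_perPoly]

/-- **Sandwich, recorded**: the crux implies the degree-`n`-only heart H up to one factor `D + 1`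
(`ryserOptimal_imp_esymBound`, Ben-Or) and is implied by it (`gradedHighDegree_of_esymHighDegree`
with `ryserOptimal_of_gradedHighDegree`). [folklore] -/
theorem ryserOptimal_of_esymHighDegree
    (h : ∃ t c : ℕ, ∀ n : ℕ, 1 ≤ n →
      ∀ (r D : ℕ) (a : Fin r → ℂ) (m : Fin r → Fin D → MvPolynomial (Fin n × Fin n) ℂ),
        (∀ i j, (m i j).IsHomogeneous 1) →
          (∑ i, C (a i) * aeval (m i) (esymm (Fin D) ℂ n)) = perPoly (Fin n) ℂ →
            n + t * Nat.log 2 (n + 2) < D → 2 ^ n ≤ r * (D + 1) * (n + 2) ^ c) :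
    Summit.ValiantsHypothesis.ValiantsHypothesis.Theses.SummationBits.RyserOptimalDepth3 :=
  ryserOptimal_of_gradedHighDegree (gradedHighDegree_of_esymHighDegree h)

end GradedHeart

end Summit.ValiantsHypothesis.ValiantsHypothesis.Theorems.SummationBitsRyserOptimalDepth3
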